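import Literature.MathematicalPhysics.QuantumLattice.QuantumRotorTruncatedSumRule
import Literature.MathematicalPhysics.QuantumLattice.QuantumRotorDensity
import Mathlib.Topology.MetricSpace.Sequences
import HarnessLib

/-!
# Quantum rotators: ground-state long-range order on the even tori (the discharge of
# `KleinPerez1992_rotorGroundStateLRO`)

Final assembly of the seat `provefact-Literature.MathematicalPhysics.QuantumLa-0bccfc6de5`
(the named fact `QuantumRotor.KleinPerez1992_rotorGroundStateLRO` of
`QuantumRotorGroundState.lean`, restated 2026-08-15 in its published torus form
[WojtkiewiczPuszStachura2016, Thm. 3.3]). No statement is touched; no named fact is introduced.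

The chain of sibling files is

* `QuantumRotorTruncated*` — the Galerkin matrices `H_M` of the rotator Hamiltonian in the
  trigonometric polynomials of degree `≤ M` per site, reflection positivity, Gaussian domination,
  the infrared bound, the sum rule and the quantitative long-range order of their tracial ground
  states `ω_M` (`truncated_groundState_lro`, Kennedy–Lieb–Shastry (5)–(8));
* `QuantumRotorFourierBridge`, `…FourierParseval`, `…Density` — trigonometric trial states,
  `energy (trialOf c) = ⟨c, H_M c⟩ + const`, `cosCorrelation (trialOf c) x y = ⟨c, B_xy c⟩`, and the
  density of trigonometric polynomials in the energy form;

and this file: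

* the Galerkin ground-state energies decrease to the variational ground-state energy
  (`eventually_galerkin_groundEnergy_le`);
* from the tracial state to a vector (`exists_unit_rayleigh_ge`): for Hermitian `A`, `O` and
  `ε > 0` a unit ground vector `v` of `A - εO` has `⟨v, O v⟩ ≥ ω_A(O)` and
  `⟨v, A v⟩ ≤ E₀(A) + ε(⟨v, O v⟩ - ω_A(O))`;
* **finite volume** (`sum_torusCorrelation_ge`): on the even torus of side `L ≥ 4`,
  `Σ_{x,y} ⟨cos(φ_x - φ_y)⟩_Λ ≥ (1 - 2√(h/8J)(2R_L + 2)) L^{2d}` for the variational ground-state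
  correlation `torusCorrelation` — the near-ground vectors `v_M` give trial states in every
  near-minimiser class `𝓔 ≤ E₀ + δ` for `M` large, a subsequence of their correlation matrices
  converges (Bolzano–Weierstrass), and the limit bounds the `inf sup` from below;
* **the fact** (`KleinPerez1992_rotorGroundStateLRO_holds`): with `R_L ≤ ρ < 1/√2` eventually
  (`klsRiemannSum_eventually_le`, `d ≥ 2`) and `J/h > 16`, the `liminf` of
  `|Λ_L|⁻² Σ_{x,y} ⟨cos(φ_x - φ_y)⟩` over the even tori is `≥ 1 - (2/11)(2 + √2) > 0`.

## References

* A. Klein, J. F. Perez, Commun. Math. Phys. 147 (1992) 241–252 [KleinPerez1992], p. 243.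
* J. Wojtkiewicz, W. Pusz, P. Stachura, Rep. Math. Phys. 77 (2016) 183–209, Thm. 3.3
  [WojtkiewiczPuszStachura2016].
* T. Kennedy, E. H. Lieb, B. S. Shastry, Phys. Rev. Lett. 61 (1988) 2582–2584 [KLS1988PRL].
-/

noncomputable section

open MeasureTheory Matrix Complex Finset Filter Topology
open scoped ENNReal NNReal ComplexOrder
open Literature.Probability.LatticeModels Literature.MathematicalPhysics.QuantumLattice

/-! ### From the tracial ground state to a near-ground vector -/

namespace Matrix

variable {n : Type*} [Fintype n] [DecidableEq n]

/-- **From the tracial ground state to a vector.** For Hermitian `A`, `O` and `ε > 0`, a unit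
ground vector `v` of `A - εO` satisfies `re ω_A(O) ≤ re ⟨v, O v⟩` and
`re ⟨v, A v⟩ ≤ E₀(A) + ε (re ⟨v, O v⟩ - re ω_A(O))` (first-order perturbation theory as two
variational inequalities: `E₀(A - εO) ≤ ω_A(A - εO)` and `E₀(A) ≤ ⟨v, A v⟩`). [folklore] -/
theorem exists_unit_rayleigh_ge [Nonempty n] {A O : Matrix n n ℂ} (hA : A.IsHermitian)
    (hO : O.IsHermitian) {ε : ℝ} (hε : 0 < ε) :
    ∃ v : n → ℂ, star v ⬝ᵥ v = 1 ∧ (A.groundStateFunctional O).re ≤ (star v ⬝ᵥ (O *ᵥ v)).re ∧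
      (star v ⬝ᵥ (A *ᵥ v)).re ≤
        A.groundEnergy + ε * ((star v ⬝ᵥ (O *ᵥ v)).re - (A.groundStateFunctional O).re) := by
  have hsa : IsSelfAdjoint (ε : ℂ) := by rw [IsSelfAdjoint, Complex.star_def, Complex.conj_ofReal]
  have hB : (A - (ε : ℂ) • O).IsHermitian := hA.sub (IsSelfAdjoint.smul hsa hO.isSelfAdjoint).isHermitian
  obtain ⟨v, hv, hvE⟩ := exists_groundState_unit hB
  have h1 := groundEnergy_le_groundStateFunctional_re hA hB
  have h2 : A.groundEnergy ≤ (star v ⬝ᵥ (A *ᵥ v)).re := groundEnergy_le_rayleigh_holds hA v hv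
  have h3 : (A.groundStateFunctional (A - (ε : ℂ) • O)).re =
      A.groundEnergy - ε * (A.groundStateFunctional O).re := by
    rw [map_sub, map_smul, groundStateFunctional_hamiltonian hA, smul_eq_mul, Complex.sub_re,
      Complex.ofReal_re, Complex.re_ofReal_mul]
  have h4 : (star v ⬝ᵥ ((A - (ε : ℂ) • O) *ᵥ v)).re =
      (star v ⬝ᵥ (A *ᵥ v)).re - ε * (star v ⬝ᵥ (O *ᵥ v)).re := by
    rw [sub_mulVec, smul_mulVec, dotProduct_sub, dotProduct_smul, smul_eq_mul, Complex.sub_re,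
      Complex.re_ofReal_mul]
  rw [h4] at hvE
  rw [h3] at h1
  have key : 0 ≤ ε * ((star v ⬝ᵥ (O *ᵥ v)).re - (A.groundStateFunctional O).re) := by linarith
  exact ⟨v, hv, by nlinarith [(mul_nonneg_iff_of_pos_left hε).1 key], by linarith⟩

omit [DecidableEq n] in
/-- The Rayleigh functional is additive in the observable. [folklore] -/
theorem star_dotProduct_sum_mulVec {ι : Type*} (s : Finset ι) (A : ι → Matrix n n ℂ) (v : n → ℂ) :
    star v ⬝ᵥ ((∑ i ∈ s, A i) *ᵥ v) = ∑ i ∈ s, star v ⬝ᵥ (A i *ᵥ v) := by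
  rw [sum_mulVec, dotProduct_sum]

end Matrix

namespace Literature.MathematicalPhysics.QuantumLattice

namespace QuantumRotor

/-! ### The Galerkin ground-state energies decrease to the variational ground-state energy -/

section Galerkin

variable {Λ : Type} [Fintype Λ] [DecidableEq Λ]

/-- Nested Galerkin ground energies: `E₀(H_{M'}) ≤ E₀(H_M)` for `M ≤ M'` (pad a ground vector).
[folklore] -/
theorem groundEnergy_truncHamiltonian_mono {h J : ℝ} (hh : 0 ≤ h) (hJ : 0 ≤ J)
    (nn : Λ → Λ → Prop) [DecidableRel nn] (hnn : ∀ x, ¬ nn x x) {M M' : ℕ} (hMM : M ≤ M') :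
    (truncHamiltonian M' nn h J).groundEnergy ≤ (truncHamiltonian M nn h J).groundEnergy := by
  obtain ⟨c, hc, hcE⟩ := exists_groundState_unit (truncHamiltonian_isHermitian M nn h J)
  have hc' : star (padCoeff hMM c) ⬝ᵥ padCoeff hMM c = 1 := by rw [star_padCoeff_dotProduct, hc]
  calc (truncHamiltonian M' nn h J).groundEnergy
      ≤ (star (padCoeff hMM c) ⬝ᵥ (truncHamiltonian M' nn h J *ᵥ padCoeff hMM c)).re :=
        groundEnergy_le_rayleigh_holds (truncHamiltonian_isHermitian M' nn h J) _ hc'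
    _ = (star c ⬝ᵥ (truncHamiltonian M nn h J *ᵥ c)).re :=
        re_star_dotProduct_truncHamiltonian_padCoeff hh hJ nn hnn hMM c hc
    _ = _ := hcE

/-- `E₀ ≤ E₀(H_M) + (J/2) Σ_x #{y ∼ x}`: a Galerkin ground vector is a trial state. [folklore] -/
theorem groundStateEnergy_le_galerkin {h J : ℝ} (hh : 0 ≤ h) (hJ : 0 ≤ J)
    (nn : Λ → Λ → Prop) [DecidableRel nn] (hnn : ∀ x, ¬ nn x x) (M : ℕ) :
    groundStateEnergy h J nn ≤ ENNReal.ofReal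
      ((truncHamiltonian M nn h J).groundEnergy + J / 2 * ∑ x, ((univ.filter (nn x)).card : ℝ)) := by
  obtain ⟨c, hc, hcE⟩ := exists_groundState_unit (truncHamiltonian_isHermitian M nn h J)
  have h := groundStateEnergy_le h J nn (trialOf M c hc)
  rwa [energy_trialOf M hh hJ nn hnn c hc, hcE] at h

/-- **The continuum limit of the Galerkin energies**: for every `δ > 0`, eventually in `M`,
`E₀(H_M) + (J/2) Σ_x #{y ∼ x} ≤ E₀ + δ` (density of trigonometric polynomials + monotonicity).
[cite: KleinPerez1992, §3] -/
theorem eventually_galerkin_groundEnergy_le [Nonempty Λ] {h J : ℝ} (hh : 0 ≤ h) (hJ : 0 ≤ J)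
    (nn : Λ → Λ → Prop) [DecidableRel nn] (hnn : ∀ x, ¬ nn x x) {δ : ℝ} (hδ : 0 < δ) :
    ∀ᶠ M : ℕ in atTop, (truncHamiltonian M nn h J).groundEnergy + J / 2 * ∑ x, ((univ.filter (nn x)).card : ℝ)
      ≤ (groundStateEnergy h J nn).toReal + δ := by
  obtain ⟨Ψ, hΨ⟩ := exists_energy_le h J nn (half_pos hδ)
  obtain ⟨M₁, c, hc, hE⟩ := exists_trialOf_energy_le hh hJ nn Ψ (half_pos hδ)
  refine eventually_atTop.2 ⟨M₁, fun M hM => ?_⟩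
  have h1 := groundEnergy_truncHamiltonian_mono hh hJ nn hnn hM
  have h2 : (truncHamiltonian M₁ nn h J).groundEnergy ≤
      (star c ⬝ᵥ (truncHamiltonian M₁ nn h J *ᵥ c)).re :=
    groundEnergy_le_rayleigh_holds (truncHamiltonian_isHermitian M₁ nn h J) c hc
  have h3 : energy h J nn (trialOf M₁ c hc) ≤ groundStateEnergy h J nn + ENNReal.ofReal δ := by
    calc _ ≤ energy h J nn Ψ + ENNReal.ofReal (δ / 2) := hE
      _ ≤ groundStateEnergy h J nn + ENNReal.ofReal (δ / 2) + ENNReal.ofReal (δ / 2) :=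
          add_le_add hΨ le_rfl
      _ = groundStateEnergy h J nn + ENNReal.ofReal δ := by
          rw [add_assoc, ← ENNReal.ofReal_add (by positivity) (by positivity), add_halves]
  rw [energy_trialOf M₁ hh hJ nn hnn c hc] at h3
  have hne : groundStateEnergy h J nn + ENNReal.ofReal δ ≠ ⊤ :=
    ENNReal.add_ne_top.2 ⟨groundStateEnergy_ne_top h J nn, ENNReal.ofReal_ne_top⟩
  have h4 := (ENNReal.ofReal_le_iff_le_toReal hne).1 h3
  rw [ENNReal.toReal_add (groundStateEnergy_ne_top h J nn) ENNReal.ofReal_ne_top,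
    ENNReal.toReal_ofReal hδ.le] at h4
  linarith

end Galerkin

/-! ### A priori bounds on the bond observables -/

section Bond

variable (M : ℕ) {Λ : Type} [Fintype Λ] [DecidableEq Λ]

/-- `B_xx = cos_x² + sin_x²` is positive semidefinite. [folklore] -/
theorem posSemidef_truncBond_self (x : Λ) : (truncBond M x x).PosSemidef := by
  have h1 := posSemidef_conjTranspose_mul_self (siteCos M x)
  have h2 := posSemidef_conjTranspose_mul_self (siteSin M x)
  rw [(siteCos_isHermitian M x).eq] at h1
  rw [(siteSin_isHermitian M x).eq] at h2
  rw [truncBond]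
  exact h1.add h2

/-- `-1 ≤ re ω(B_xy)` for the tracial ground state of any matrix. [folklore] -/
theorem neg_one_le_re_groundStateFunctional_truncBond [Nonempty Λ] {A : Op Λ (2 * M + 1)}
    (hA : A.IsHermitian) (x y : Λ) : -1 ≤ (A.groundStateFunctional (truncBond M x y)).re := by
  by_cases hxy : x = y
  · subst hxy
    have h := (Complex.nonneg_iff.mp
      (groundStateFunctional_nonneg_of_posSemidef A (posSemidef_truncBond_self M x))).1
    linarith
  · have h := (Complex.nonneg_iff.mp
      (groundStateFunctional_nonneg_of_posSemidef A (posSemidef_one_add_truncBond M hxy))).1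
    rw [map_add, groundStateFunctional_one hA, Complex.add_re, Complex.one_re] at h
    linarith

end Bond

/-! ### Finite volume: long-range order of the variational ground-state correlation -/

section Torus

variable {d : ℕ}

/-- The constants of `truncated_groundState_lro` converge, as `M → ∞`, to
`1 - 2 √(h/(8J)) (2R + 2)` (they are a continuous function of `t = 1/M`). [folklore] -/
theorem tendsto_lroConst (d : ℕ) {h : ℝ} (hh : h ≠ 0) (J R : ℝ) :
    Tendsto (fun M : ℕ => 1 - d * J / (h * (M : ℝ) ^ 2) -
        2 * Real.sqrt ((h + J * (2 * (M : ℝ)⁻¹ * d +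
          (d / (2 * (M : ℝ)⁻¹) + d / 2) * (2 * d * J * 1 / (h * (M : ℝ) ^ 2)))) / (8 * J)) * (2 * R + 2))
      atTop (𝓝 (1 - 2 * Real.sqrt (h / (8 * J)) * (2 * R + 2))) := by
  set F : ℝ → ℝ := fun t => 1 - d * J * t ^ 2 / h -
    2 * Real.sqrt ((h + J * (2 * t * d + d ^ 2 * J / h * (t + t ^ 2))) / (8 * J)) * (2 * R + 2) with hF
  have hFc : Continuous F := by
    rw [hF]
    fun_prop
  have h0 : F 0 = 1 - 2 * Real.sqrt (h / (8 * J)) * (2 * R + 2) := by norm_num [hF]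
  have hT := (hFc.tendsto 0).comp (tendsto_inv_atTop_nhds_zero_nat (𝕜 := ℝ))
  rw [h0] at hT
  refine hT.congr' (eventually_atTop.2 ⟨1, fun M hM => ?_⟩)
  have hM0 : (M : ℝ) ≠ 0 := by positivity
  have e1 : (d : ℝ) * J * ((M : ℝ)⁻¹) ^ 2 / h = d * J / (h * (M : ℝ) ^ 2) := by
    field_simp
  have e2 : (2 * (M : ℝ)⁻¹ * d + d ^ 2 * J / h * ((M : ℝ)⁻¹ + ((M : ℝ)⁻¹) ^ 2)) =
      2 * (M : ℝ)⁻¹ * d + (d / (2 * (M : ℝ)⁻¹) + d / 2) * (2 * d * J * 1 / (h * (M : ℝ) ^ 2)) := by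
    field_simp
  simp only [Function.comp_apply, hF]
  rw [e1, e2]

/-- **Finite-volume long-range order of the variational ground-state correlation.** On the even
torus of side `L ≥ 4` (`d ≥ 1`, `h, J > 0`):
`(1 - 2√(h/(8J)) (2 R_L + 2)) L^{2d} ≤ Σ_{x,y} ⟨cos(φ_x - φ_y)⟩_Λ`,
`R_L = klsRiemannSum d L`. (The rotator version of Kennedy–Lieb–Shastry (8); the passage from the
Galerkin ground states to the variational correlation is by density and compactness.)
[cite: WojtkiewiczPuszStachura2016, Thm. 3.3] [cite: KLS1988PRL, eq. (8)] -/
theorem sum_torusCorrelation_ge (hd : 1 ≤ d) {L : ℕ} [NeZero L] (hLe : Even L) (h4 : 4 ≤ L) {h J : ℝ}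
    (hh : 0 < h) (hJ : 0 < J) :
    (1 - 2 * Real.sqrt (h / (8 * J)) * (2 * klsRiemannSum d L + 2)) * ((L : ℝ) ^ d) ^ 2 ≤
      ∑ x : TorusSite d L, ∑ y : TorusSite d L, torusCorrelation d L h J x y := by
  have hnn : ∀ x, ¬ (torusGraph d L).Adj x x := fun x => (torusGraph d L).irrefl
  set E : ℝ≥0∞ := groundStateEnergy h J (torusGraph d L).Adj with hE_def
  set K : ℝ := J / 2 * ∑ x : TorusSite d L, ((univ.filter ((torusGraph d L).Adj x)).card : ℝ) with hK_def
  set Nsq : ℝ := ((Fintype.card (TorusSite d L) : ℕ) : ℝ) ^ 2 with hNsq_def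
  have hH : ∀ M : ℕ, (truncHamiltonian M (torusGraph d L).Adj h J).IsHermitian := fun M =>
    truncHamiltonian_isHermitian M _ h J
  have hO : ∀ M : ℕ, (∑ x : TorusSite d L, ∑ y : TorusSite d L, truncBond M x y :
      Op (TorusSite d L) (2 * M + 1)).IsHermitian := fun M =>
    (isSelfAdjoint_sum _ fun x _ => isSelfAdjoint_sum _ fun y _ =>
      (truncBond_isHermitian M x y).isSelfAdjoint).isHermitian
  -- the near-ground vectors `v M` of `H_M - ε_M O_M`, `ε_M = 1/(M+1)`
  have hε : ∀ M : ℕ, (0 : ℝ) < 1 / ((M : ℝ) + 1) := fun M => by positivity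
  choose v hv hge hEn using fun M : ℕ => Matrix.exists_unit_rayleigh_ge (hH M) (hO M) (hε M)
  -- their trial states and correlation matrices
  set u : ℕ → TorusSite d L × TorusSite d L → ℝ := fun M p =>
    cosCorrelation (trialOf M (v M) (hv M)) p.1 p.2 with hu_def
  have hu1 : ∀ M p, |u M p| ≤ 1 := fun M p => abs_cosCorrelation_le_one _ _ _
  -- (a) the Rayleigh sum of the bonds is below the correlation sum
  have hOv : ∀ M, (star (v M) ⬝ᵥ ((∑ x, ∑ y, truncBond M x y) *ᵥ v M)).re ≤ ∑ p, u M p := by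
    intro M
    rw [Matrix.star_dotProduct_sum_mulVec, Complex.re_sum, Fintype.sum_prod_type]
    refine sum_le_sum fun x _ => ?_
    rw [Matrix.star_dotProduct_sum_mulVec, Complex.re_sum]
    exact sum_le_sum fun y _ => re_star_dotProduct_truncBond_le_cosCorrelation M x y (v M) (hv M)
  -- (b) `Σ_p u_M(p) ≤ N²` and `re ω(O) ≥ -N²`
  have hsum_le : ∀ M, ∑ p, u M p ≤ Nsq := by
    intro M
    calc ∑ p, u M p ≤ ∑ _p : TorusSite d L × TorusSite d L, (1 : ℝ) :=
          sum_le_sum fun p _ => (abs_le.1 (hu1 M p)).2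
      _ = Nsq := by simp [hNsq_def, Fintype.card_prod, sq]
  have hω_ge : ∀ M, -Nsq ≤ ((truncHamiltonian M (torusGraph d L).Adj h J).groundStateFunctional
      (∑ x, ∑ y, truncBond M x y)).re := by
    intro M
    rw [map_sum, Complex.re_sum]
    have h1 : ∀ x, -((Fintype.card (TorusSite d L) : ℕ) : ℝ) ≤
        ((truncHamiltonian M (torusGraph d L).Adj h J).groundStateFunctional (∑ y, truncBond M x y)).re := by
      intro x
      rw [map_sum, Complex.re_sum]
      calc -((Fintype.card (TorusSite d L) : ℕ) : ℝ) = ∑ _y : TorusSite d L, (-1 : ℝ) := by simp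
        _ ≤ _ := sum_le_sum fun y _ => neg_one_le_re_groundStateFunctional_truncBond M (hH M) x y
    calc -Nsq = ∑ _x : TorusSite d L, -((Fintype.card (TorusSite d L) : ℕ) : ℝ) := by
          simp [hNsq_def, sq]
      _ ≤ _ := sum_le_sum fun x _ => h1 x
  -- (c) the Galerkin energy of `v M`: `re ⟨v, H v⟩ ≤ E₀(H_M) + 2N²/(M+1)`
  have hvH : ∀ M, (star (v M) ⬝ᵥ (truncHamiltonian M (torusGraph d L).Adj h J *ᵥ v M)).re ≤
      (truncHamiltonian M (torusGraph d L).Adj h J).groundEnergy + 1 / ((M : ℝ) + 1) * (2 * Nsq) := by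
    intro M
    refine (hEn M).trans (add_le_add le_rfl (mul_le_mul_of_nonneg_left ?_ (hε M).le))
    linarith [hOv M, hsum_le M, hω_ge M]
  -- (d) for every `δ > 0`, eventually `trialOf (v M)` is a `δ`-near-minimiser
  have hnear : ∀ δ : ℝ, 0 < δ → ∀ᶠ M : ℕ in atTop,
      energy h J (torusGraph d L).Adj (trialOf M (v M) (hv M)) ≤ E + ENNReal.ofReal δ := by
    intro δ hδ
    have h1 := eventually_galerkin_groundEnergy_le hh.le hJ.le (torusGraph d L).Adj hnn (half_pos hδ)
    have h2 : ∀ᶠ M : ℕ in atTop, 1 / ((M : ℝ) + 1) * (2 * Nsq) ≤ δ / 2 := by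
      have ht : Tendsto (fun M : ℕ => 1 / ((M : ℝ) + 1) * (2 * Nsq)) atTop (𝓝 (0 * (2 * Nsq))) :=
        tendsto_one_div_add_atTop_nhds_zero_nat.mul_const _
      rw [zero_mul] at ht
      exact ht.eventually (eventually_le_nhds (half_pos hδ))
    filter_upwards [h1, h2] with M hM1 hM2
    rw [energy_trialOf M hh.le hJ.le _ hnn (v M) (hv M)]
    have hEt : E ≠ ⊤ := groundStateEnergy_ne_top h J _
    calc ENNReal.ofReal ((star (v M) ⬝ᵥ (truncHamiltonian M (torusGraph d L).Adj h J *ᵥ v M)).re + K)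
        ≤ ENNReal.ofReal (E.toReal + δ) := ENNReal.ofReal_le_ofReal (by linarith [hvH M])
      _ = E + ENNReal.ofReal δ := by
          rw [ENNReal.ofReal_add ENNReal.toReal_nonneg hδ.le, ENNReal.ofReal_toReal hEt]
  -- (e) the correlation sums are bounded below by the KLS constants
  set β : ℕ → ℝ := fun M => 1 - d * J / (h * (M : ℝ) ^ 2) -
        2 * Real.sqrt ((h + J * (2 * (M : ℝ)⁻¹ * d +
          (d / (2 * (M : ℝ)⁻¹) + d / 2) * (2 * d * J * 1 / (h * (M : ℝ) ^ 2)))) / (8 * J)) *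
          (2 * klsRiemannSum d L + 2) with hβ_def
  have hpos : (0 : ℝ) < ((L : ℝ) ^ d) ^ 2 := by positivity
  have hβ : ∀ M, 1 ≤ M → β M * ((L : ℝ) ^ d) ^ 2 ≤ ∑ p, u M p := by
    intro M hM
    have hF4 := truncated_groundState_lro (L := L) (M := M) hd hLe h4 hM hh hJ
    rw [le_div_iff₀ hpos] at hF4
    refine hF4.trans ((le_of_eq ?_).trans ((hge M).trans (hOv M)))
    rw [map_sum, Complex.re_sum]
    exact sum_congr rfl fun x _ => by rw [map_sum, Complex.re_sum]
  -- (f) Bolzano–Weierstrass: a convergent subsequence of the correlation matrices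
  have hbd : ∀ M, u M ∈ Metric.closedBall (0 : TorusSite d L × TorusSite d L → ℝ) 1 := by
    intro M
    rw [Metric.mem_closedBall, dist_zero_right, pi_norm_le_iff_of_nonneg zero_le_one]
    exact fun p => by rw [Real.norm_eq_abs]; exact hu1 M p
  obtain ⟨g, -, φ, hφ, hT⟩ := tendsto_subseq_of_bounded Metric.isBounded_closedBall hbd
  have hTp : ∀ p, Tendsto (fun j => u (φ j) p) atTop (𝓝 (g p)) := fun p => tendsto_pi_nhds.1 hT p
  -- (g) the limit bounds every `sup` over near-minimisers from below, hence `G ≥ g`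
  have hG : ∀ p : TorusSite d L × TorusSite d L,
      g p ≤ groundStateCorrelation h J (torusGraph d L).Adj p.1 p.2 := by
    intro p
    haveI : Nonempty {δ : ℝ // 0 < δ} := ⟨⟨1, one_pos⟩⟩
    refine le_ciInf fun δ => ?_
    have hev : ∀ᶠ j in atTop, u (φ j) p ≤ ⨆ Ψ : {Ψ : TrialState (TorusSite d L) //
        energy h J (torusGraph d L).Adj Ψ ≤ groundStateEnergy h J (torusGraph d L).Adj + ENNReal.ofReal δ.1},
          cosCorrelation Ψ.1 p.1 p.2 := by
      filter_upwards [hφ.tendsto_atTop.eventually (hnear δ.1 δ.2)] with j hj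
      exact le_ciSup_of_le ⟨1, by rintro _ ⟨Ψ, rfl⟩; exact cosCorrelation_le_one _ _ _⟩
        ⟨trialOf (φ j) (v (φ j)) (hv (φ j)), hj⟩ le_rfl
    exact le_of_tendsto (hTp p) hev
  -- (h) the sum of the limit is the limit of the sums, `≥ lim β(φ j) L^{2d}`
  have hsumT : Tendsto (fun j => ∑ p, u (φ j) p) atTop (𝓝 (∑ p, g p)) :=
    tendsto_finsetSum _ fun p _ => hTp p
  have hβT : Tendsto (fun j => β (φ j) * ((L : ℝ) ^ d) ^ 2) atTop
      (𝓝 ((1 - 2 * Real.sqrt (h / (8 * J)) * (2 * klsRiemannSum d L + 2)) * ((L : ℝ) ^ d) ^ 2)) :=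
    ((tendsto_lroConst d hh.ne' J (klsRiemannSum d L)).comp hφ.tendsto_atTop).mul_const _
  have hlim : (1 - 2 * Real.sqrt (h / (8 * J)) * (2 * klsRiemannSum d L + 2)) * ((L : ℝ) ^ d) ^ 2 ≤
      ∑ p, g p :=
    le_of_tendsto_of_tendsto hβT hsumT (eventually_atTop.2 ⟨1, fun j hj => hβ (φ j) (hj.trans (hφ.id_le j))⟩)
  -- (i) conclusion
  calc _ ≤ ∑ p, g p := hlim
    _ ≤ ∑ p : TorusSite d L × TorusSite d L, groundStateCorrelation h J (torusGraph d L).Adj p.1 p.2 :=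
        sum_le_sum fun p _ => hG p
    _ = _ := by
        rw [Fintype.sum_prod_type]
        exact sum_congr rfl fun x _ => sum_congr rfl fun y _ => (torusCorrelation_of_neZero d L h J x y).symm

/-- The LRO sequence of the fact is bounded by `1`. [folklore] -/
theorem lroSeq_le_one (d : ℕ) (h J : ℝ) (k : ℕ) :
    (∑ x ∈ halfOpenBox d (2 * k), ∑ y ∈ halfOpenBox d (2 * k),
        torusCorrelation d (2 * k) h J (Torus.proj (2 * k) x) (Torus.proj (2 * k) y)) /
      ((halfOpenBox d (2 * k)).card : ℝ) ^ 2 ≤ 1 := by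
  refine div_le_one_of_le₀ ?_ (by positivity)
  calc ∑ x ∈ halfOpenBox d (2 * k), ∑ y ∈ halfOpenBox d (2 * k),
        torusCorrelation d (2 * k) h J (Torus.proj (2 * k) x) (Torus.proj (2 * k) y)
      ≤ ∑ x ∈ halfOpenBox d (2 * k), ∑ y ∈ halfOpenBox d (2 * k), (1 : ℝ) :=
        sum_le_sum fun x _ => sum_le_sum fun y _ => (abs_le.1 (abs_torusCorrelation_le_one _ _ _ _ _ _)).2
    _ = ((halfOpenBox d (2 * k)).card : ℝ) ^ 2 := by simp [sq]

/-- On the even torus of side `2k ≥ 4` the LRO sequence of the fact is at least the KLS constant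
`1 - 2√(h/(8J)) (2 R_{2k} + 2)`. [cite: WojtkiewiczPuszStachura2016, Thm. 3.3] -/
theorem lroConst_le_lroSeq (hd : 1 ≤ d) {h J : ℝ} (hh : 0 < h) (hJ : 0 < J) {k : ℕ} (hk : 2 ≤ k) :
    1 - 2 * Real.sqrt (h / (8 * J)) * (2 * klsRiemannSum d (2 * k) + 2) ≤
      (∑ x ∈ halfOpenBox d (2 * k), ∑ y ∈ halfOpenBox d (2 * k),
          torusCorrelation d (2 * k) h J (Torus.proj (2 * k) x) (Torus.proj (2 * k) y)) /
        ((halfOpenBox d (2 * k)).card : ℝ) ^ 2 := by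
  haveI : NeZero (2 * k) := ⟨by omega⟩
  have hsum := sum_torusCorrelation_ge (L := 2 * k) hd ⟨k, two_mul k⟩ (by omega) hh hJ
  have hre := XYOrderProofs.sum_halfOpenBox_torusPullback (fun L x y => torusCorrelation d L h J x y) (2 * k)
  simp only [torusPullback_apply] at hre
  rw [hre, card_halfOpenBox, le_div_iff₀ (by positivity)]
  push_cast at hsum ⊢
  exact hsum

/-- **Discharge of the named fact `KleinPerez1992_rotorGroundStateLRO`**: ground-state long-range
order of the ferromagnetic quantum rotators on the even tori of `ℤ^d`, `d ≥ 2`, whenever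
`J/h > α_c := 16` (not optimised: any `α_c` with `2 √(1/(8 α_c)) (2 + √2) < 1` would do, and the
published threshold is not optimised either). Proof: `sum_torusCorrelation_ge` on every even
torus; `R_L ≤ ρ < 1/√2 < 0.71` eventually (`klsRiemannSum_eventually_le`) and
`√(h/(8J)) ≤ √(1/128) ≤ 1/11`, so the LRO sequence is eventually
`≥ 1 - (2/11)(2 max(ρ,0) + 2) > 0`, while it is always `≤ 1`.
[cite: WojtkiewiczPuszStachura2016, Thm. 3.3] [cite: KleinPerez1992, p. 243] -/
theorem KleinPerez1992_rotorGroundStateLRO_holds : KleinPerez1992_rotorGroundStateLRO := by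
  intro d hd
  refine ⟨16, by norm_num, fun h J hh hJ hα => ?_⟩
  rw [hasLongRangeOrder_torusCorrelation_iff]
  have hd1 : 1 ≤ d := by omega
  obtain ⟨ρ, hρ, hρev⟩ := klsRiemannSum_eventually_le d hd
  -- the constant
  have hsqrt2 : Real.sqrt 2 < 1.42 := by
    rw [Real.sqrt_lt' (by norm_num)]
    norm_num
  have hρ' : ρ < 0.71 := by linarith
  have hx : h / (8 * J) ≤ 1 / 128 := by
    rw [div_le_div_iff₀ (by positivity) (by norm_num)]
    have : 16 * h < J := by rwa [lt_div_iff₀ hh] at hα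
    linarith
  have hs : Real.sqrt (h / (8 * J)) ≤ 1 / 11 := by
    calc Real.sqrt (h / (8 * J)) ≤ Real.sqrt (1 / 128) := Real.sqrt_le_sqrt hx
      _ ≤ 1 / 11 := by
          rw [Real.sqrt_le_left (by norm_num)]
          norm_num
  set c : ℝ := 1 - 2 * (1 / 11) * (2 * max ρ 0 + 2) with hc_def
  have hρ0 : 0 ≤ max ρ 0 := le_max_right _ _
  have hρ0' : max ρ 0 < 0.71 := max_lt hρ' (by norm_num)
  have hc : 0 < c := by rw [hc_def]; nlinarith
  -- eventually `R_{2k} ≤ max ρ 0`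
  have h2k : Tendsto (fun k : ℕ => 2 * k) atTop atTop :=
    tendsto_atTop_atTop.2 fun b => ⟨b, fun k hk => by omega⟩
  have hRk : ∀ᶠ k : ℕ in atTop, klsRiemannSum d (2 * k) ≤ max ρ 0 :=
    (h2k.eventually hρev).mono fun k hk => hk.trans (le_max_left _ _)
  have hev : ∀ᶠ k : ℕ in atTop, c ≤
      (∑ x ∈ halfOpenBox d (2 * k), ∑ y ∈ halfOpenBox d (2 * k),
          torusCorrelation d (2 * k) h J (Torus.proj (2 * k) x) (Torus.proj (2 * k) y)) /
        ((halfOpenBox d (2 * k)).card : ℝ) ^ 2 := by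
    filter_upwards [hRk, eventually_ge_atTop 2] with k hk hk2
    refine le_trans ?_ (lroConst_le_lroSeq hd1 hh hJ hk2)
    rw [hc_def]
    have hR0 : 0 ≤ klsRiemannSum d (2 * k) := klsRiemannSum_nonneg _ _
    have hs0 : 0 ≤ Real.sqrt (h / (8 * J)) := Real.sqrt_nonneg _
    nlinarith [mul_le_mul hs (show 2 * klsRiemannSum d (2 * k) + 2 ≤ 2 * max ρ 0 + 2 by linarith)
      (by linarith) (by norm_num)]
  exact hc.trans_le (le_liminf_of_le (isCoboundedUnder_ge_of_le atTop fun k => lroSeq_le_one d h J k) hev)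

end Torus

end QuantumRotor

end Literature.MathematicalPhysics.QuantumLattice
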